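import Literature.AlgebraicGeometry.CossartPiltant200819.Threefolds2008
import Literature.AlgebraicGeometry.Resolution.ArithmeticalThreefoldsLocalRankReduction
import Literature.AlgebraicGeometry.Resolution.AffineDomainDimension
import Literature.AlgebraicGeometry.Resolution.ExcellentRingsFieldProofs
import Literature.AlgebraicGeometry.Resolution.TranscendenceDefect
import HarnessLib

/-!
# Cossart–Piltant 2008, Proposition 5.1: the leaf `RankReduction` from resolution of surfaces

[CP-I] = V. Cossart, O. Piltant, *Resolution of singularities of threefolds in positive
characteristic I*, J. Algebra 320 (2008) 1051–1082 (HAL hal-00139124), §5, PRINTED TEXT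
(HAL p. 16, l. 14–16):

> **Proposition 5.1.** Let `K/k` be a function field of dimension three and `V/k` be a
> `k`-valuation ring such that `QF(V) = K` and either `V` has rank greater than one or
> `κ(V)/k` is transcendental. Then `V/k` has a local uniformization.

In the verbatim rendering `Threefolds2008.lean` this is the named leaf
`CP2008.RankReduction : Prop` ("every valuation of `K/k`, `trdeg 3`, which is NOT of rank one or
whose residue field is NOT algebraic over `k` admits local uniformization"), so far derived in the
tree only from the full theorem `CossartPiltant2019LU3` (`Bridge2019.rankReduction_of_…`).
NOTATION OF THIS MODULE (not the print's): the two cases of the hypothesis are labelled below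
"`κ(V)/k` transcendental" (the section headed `dim V₀ > 0` in the tree's 2019-frame twin
`Resolution.ArithmeticalThreefoldsLocalRankReduction`, where `V₀` is the residue side) and
"rank `> 1`" (there: `rk Γ > 1`, `Γ` the value group). In the PRINT, `V₀` denotes something else:
the residually transcendental FACTOR of the composite valuation `V = V₀ ∘ V̄` in the rank `> 1`
case (HAL p. 16, l. 22–25: "Let `V` be composed of the valuation ring `V₀` and of the rank one
`k`-valuation ring `V̄`"); that symbol is not used here.

This module PROVES the leaf from the one external input it genuinely needs, resolution of
singularities of excellent (quasi-excellent reduced Noetherian) schemes of dimension `≤ 2`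
(`Resolution.CossartJannsenSaito2020General`, [CJS] Thm. 1.2). The printed proof invokes its
dimension-two input three times — "By e.g. [36], there exists a local uniformization of `V/k(t)`,
hence of `V/k` since `k(t) ⊂ V`" (HAL p. 16, l. 18–19, case `κ(V)/k` transcendental), "Again by
[36], there exists a local uniformization `S̄` of `V̄ ∩ K₁` dominating `R̄₁`" (l. 41–42) and "Since
principalisation of ideals holds in dimension `τ` (`τ ≤ 2`), `m_{V₀} ∩ S_m` itself becomes a
permissible center for some `m ≥ 0`" (HAL p. 17, l. 9–11), [36] = J. Lipman, *Desingularization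
of two-dimensional schemes*, Ann. Math. 107 (1978) — and [CJS] Thm. 1.2 stands in for [36] here.
ROUTE: this is a reproduction of the STATEMENT along a DIFFERENT PUBLISHED ROUTE than the
print's. The print (HAL pp. 16–17) builds the explicit local models
`R₁ = k[t₁,…,t_τ, t₁^{a₁}f₁, …]_{m_V ∩ …}` with `(R₁)_{m_{V₀} ∩ R₁} = R₀`, lifts a local
uniformization `S̄` of `V̄ ∩ K₁` to `S`, obtains a local model whose regular subspace "has
maximal contact along `V` in the sense of Hironaka [21]" (HAL p. 17, l. 3–4; [21] = J. Giraud,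
*Contact maximal en caractéristique positive*, Ann. Sc. ENS (4) 8 (1975)) and finishes by
permissible (normally flat) monoidal transforms at primes `P_i ⊇ m_{V₀} ∩ S_i` plus
principalisation in dimension `τ`; none of that is formalised. Instead the rank `> 1` case goes
through Novacoski–Spivakovsky's rendering of Zariski's composite-valuation argument
(J. Novacoski, M. Spivakovsky, *Reduction of local uniformization to the rank one case*,
arXiv:1204.4751, Cor. 2.14, Cor. 2.17, §3.1; bib key `NovacoskiSpivakovsky2014`), already
formalised in
`Resolution.RankOneReductionProofs` / `Resolution.ArithmeticalThreefoldsLocalRankReduction`, with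
BOTH of its inputs supplied by [CJS]; and the residually transcendental case keeps the base field
`k` (instead of passing to `k(t)`) and applies [CJS] to the local ring at a non-maximal centre:

* `isLocallyUniformizable_of_trdeg_le_two_of_cjs` — local uniformization of EVERY valuation of a
  finitely generated `K/k` with `trdeg_k K ≤ 2` (an affine model has an excellent local ring of
  dimension `≤ 2` at the centre; `exists_model_regular_of_cjs`) — the tree's form of what the
  print takes from [36].
* `dims_of_separating_affineModel`, `exists_affineModel_regular_of_lt_of_cjs` — the case
  rank `> 1`: `V < V₁ < K`, an affine model `R[x]` with `x ∈ 𝔪_V ∖ 𝔪_{V₁}` has `dim R[x]_P ≤ 2`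
  at the centre `P` of `V₁` and `ht(Q/P) ≤ 2`; resolution of surfaces uniformizes `ν₁`
  (Cor. 2.14) and `ν₂` above the residue model (Cor. 2.17), and Novacoski–Spivakovsky's §3.1 step
  glues (`novacoskiSpivakovsky2014_cor214/217/step`). This is the field-base twin of
  `Resolution.exists_model_regular_of_lt_of_cjs` (there the base is a three-dimensional local
  ring `S` and `dim A_Q ≤ 3` comes from Matsumura 15.5; here `dim A ≤ trdeg_k K = 3`).
* `isLocallyUniformizable_of_residueTrdeg_ne_zero_of_cjs` — the case `κ(V)/k` transcendental:
  adjoining to an affine model a lift `y` of a residue-transcendental element makes the centre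
  `P` NON-maximal (`R/P ⊇ k[ȳ]` has positive transcendence degree, hence positive dimension by
  the dimension formula `exists_ringKrullDim_eq_and_trdeg_eq`), so `ht P ≤ dim R - 1 ≤ 2` and
  resolution of surfaces applies to `R_P` directly (the print instead works over `k(t)`, where
  `K/k(t)` has transcendence degree two, HAL p. 16, l. 17–19).
* `rankReduction_of_cjs : CossartJannsenSaito2020General → CP2008.RankReduction` — the leaf.

Consequently `CP2008.lu3_of_leaves` / the [CP-I] assembly modules may take resolution of
excellent surfaces in place of the leaf `p51 : RankReduction`.

All statements are over a FIELD `k` of arbitrary characteristic (the printed `k` has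
characteristic `p > 0`, which is not used in §5).
-/

universe u

open IsLocalRing Polynomial Algebra
open Literature.AlgebraicGeometry.Resolution

namespace Literature.AlgebraicGeometry.CossartPiltant200819.CP2008

/-! ## Transcendence degree `≤ 2`: every valuation is uniformizable -/

section TrdegTwo

variable {k K : Type u} [Field k] [Field K] [Algebra k K]

/-- **Local uniformization in transcendence degree `≤ 2` from resolution of excellent surfaces**
(the dimension-two input which the printed proof of [CP-I] Prop. 5.1 takes from [36] = Lipman
1978 — "By e.g. [36]" (HAL p. 16, l. 18), "Again by [36]" (l. 41) — here supplied by [CJS]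
Thm. 1.2): every `k`-valuation ring `O` of a finitely generated extension `K/k` with
`trdeg_k K ≤ 2` dominates a regular local ring of a finitely generated model. Proof: an affine
model `R ⊆ O` with `Frac R = K` (`exists_affineModel`) has `dim R ≤ 2`
(`ringKrullDim_le_of_fg_of_trdeg_le`), so its local ring at the centre is excellent
(`isExcellentRing_localization_atPrime`) of dimension `≤ 2`, and `exists_model_regular_of_cjs`
(resolution of `Spec` of that local ring, read back as a model) gives the regular model.
[cite: CossartPiltant2008, proof of Prop. 5.1 (HAL p. 16)] [cite: CossartJannsenSaito2020, Thm. 1.2] -/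
theorem isLocallyUniformizable_of_trdeg_le_two_of_cjs (hCJS : CossartJannsenSaito2020General.{u})
    (hfg : (⊤ : IntermediateField k K).FG) (h2 : Algebra.trdeg k K ≤ 2)
    (O : ValuationSubring K) (hk : ∀ c : k, algebraMap k K c ∈ O) :
    IsLocallyUniformizable k K O := by
  classical
  obtain ⟨R, hRO, hRfg, hRfr⟩ := exists_affineModel k K hfg O hk
  haveI := hRfr
  haveI : IsNoetherianRing R := isNoetherianRing_of_fg hRfg
  haveI : Algebra.FiniteType k R := (Subalgebra.fg_iff_finiteType _).mp hRfg
  let P : Ideal R := (maximalIdeal O).comap (Subring.inclusion hRO)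
  haveI : P.IsPrime := Ideal.IsPrime.comap _
  have hP : ∀ z : R, z ∈ P ↔ O.valuation (z : K) < 1 := fun z => by
    rw [Ideal.mem_comap, ValuationSubring.valuation_lt_one_iff]; rfl
  have hexc : IsExcellentRing (Localization.AtPrime P) :=
    isExcellentRing_localization_atPrime (isExcellentRing_of_field k) P
  have hdimR : ringKrullDim R ≤ (2 : ℕ) :=
    ringKrullDim_le_of_fg_of_trdeg_le R hRfg (by exact_mod_cast h2)
  have hdim : ringKrullDim (Localization.AtPrime P) ≤ 2 := by
    rw [IsLocalization.AtPrime.ringKrullDim_eq_height P (Localization.AtPrime P)]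
    exact Ideal.height_le_ringKrullDim_of_isPrime.trans (by exact_mod_cast hdimR)
  obtain ⟨A, hA, hRA, hAfg, hreg⟩ := exists_model_regular_of_cjs hCJS O R hRfg hRO P hP hexc hdim
  exact ⟨A, hA, hAfg, isFractionRing_subalgebra_of_le R A hRA, hreg⟩

end TrdegTwo

/-! ## Composite valuations (rank `> 1`; module notation `rk Γ > 1`): the two pieces have dimension `≤ 2` -/

section Composite

variable {k K : Type u} [Field k] [Field K] [Algebra k K]

/-- **The two pieces of a composite valuation of a threefold have dimension `≤ 2`** (field-base
twin of `Resolution.dims_of_separating_model`; [NS14] §3.1): for `O ≤ O₁ ≠ K` valuation rings of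
`K`, `A ⊆ O` a finitely generated `k`-model with `Frac A = K`, `dim A ≤ 3`, containing an element
`x` of `𝔪_O ∖ 𝔪_{O₁}`, and `Q ⊇ P` the centres of `O`, `O₁` on `A`: `0 ≠ P ⊊ Q`, hence
`dim A_P = ht P ≤ 2` and `ht (Q/P) ≤ 2` (`ht P + ht (Q/P) ≤ ht Q ≤ dim A ≤ 3`).
[cite: NovacoskiSpivakovsky2014, §3.1] [cite: CossartPiltant2008, proof of Prop. 5.1 (HAL p. 16)] -/
theorem dims_of_separating_affineModel (O O₁ : ValuationSubring K) (hO : O ≤ O₁) (hO₁ : O₁ ≠ ⊤)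
    (A : Subalgebra k K) (hAfg : A.FG) [IsFractionRing A K] (hA : A.toSubring ≤ O.toSubring)
    (hdimA : ringKrullDim A ≤ 3)
    (x : K) (hxA : x ∈ A) (hxO : O.valuation x < 1) (hxO₁ : O₁.valuation x = 1)
    (Q P : Ideal A) [Q.IsPrime] [P.IsPrime]
    (hQ : ∀ z : A, z ∈ Q ↔ O.valuation (z : K) < 1)
    (hP : ∀ z : A, z ∈ P ↔ O₁.valuation (z : K) < 1) :
    P ≤ Q ∧ ringKrullDim (Localization.AtPrime P) ≤ 2 ∧
      (Q.map (Ideal.Quotient.mk P)).height ≤ 2 := by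
  classical
  haveI : IsNoetherianRing A := isNoetherianRing_of_fg hAfg
  have hAO : ∀ z : A, (z : K) ∈ O := fun z => hA z.2
  -- `P ≤ Q`, `P ≠ Q`
  have hPQ : P ≤ Q := by
    intro z hz
    rw [hP] at hz
    rw [hQ]
    by_contra hnot
    have hz0 : (z : K) ≠ 0 := fun h0 => hnot (by rw [h0, map_zero]; exact zero_lt_one)
    have hz1 : O.valuation (z : K) = 1 :=
      le_antisymm ((O.valuation_le_one_iff _).mpr (hAO z)) (not_lt.mp hnot)
    have hzinv : (z : K)⁻¹ ∈ O := by rw [← O.valuation_le_one_iff, map_inv₀, hz1, inv_one]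
    have h1 : O₁.valuation ((z : K)⁻¹) ≤ 1 := (O₁.valuation_le_one_iff _).mpr (hO hzinv)
    have h2 : O₁.valuation ((z : K) * (z : K)⁻¹) < 1 := by
      rw [map_mul]
      calc O₁.valuation (z : K) * O₁.valuation ((z : K)⁻¹)
          ≤ O₁.valuation (z : K) * 1 := by gcongr
        _ = O₁.valuation (z : K) := mul_one _
        _ < 1 := hz
    rw [mul_inv_cancel₀ hz0, map_one] at h2
    exact lt_irrefl _ h2
  have hxQ : (⟨x, hxA⟩ : A) ∈ Q := (hQ _).mpr hxO
  have hxP : (⟨x, hxA⟩ : A) ∉ P := fun h => by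
    have := (hP _).mp h
    rw [hxO₁] at this
    exact lt_irrefl _ this
  have hlt : P < Q := lt_of_le_of_ne hPQ fun h => hxP (h ▸ hxQ)
  -- `P ≠ 0`
  have hPbot : (⊥ : Ideal A) < P := by
    rw [bot_lt_iff_ne_bot]
    intro hP0
    apply hO₁
    ext z
    simp only [ValuationSubring.mem_top, iff_true]
    obtain ⟨a, b, hb, rfl⟩ := IsFractionRing.div_surjective (A := A) z
    have hb0 : b ≠ 0 := nonZeroDivisors.ne_zero hb
    have hbP : b ∉ P := by rw [hP0]; exact hb0
    have hb1 : O₁.valuation (b : K) = 1 :=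
      le_antisymm ((O₁.valuation_le_one_iff _).mpr (hO (hAO b)))
        (not_lt.mp fun hlt' => hbP ((hP b).mpr hlt'))
    change (a : K) / (b : K) ∈ O₁
    rw [div_eq_mul_inv]
    refine mul_mem (hO (hAO a)) ?_
    rw [← O₁.valuation_le_one_iff, map_inv₀, hb1, inv_one]
  -- heights
  haveI hQ' : (Q.map (Ideal.Quotient.mk P)).IsPrime :=
    Ideal.map_isPrime_of_surjective Ideal.Quotient.mk_surjective (by rwa [Ideal.mk_ker])
  obtain ⟨a, ha⟩ := ENat.ne_top_iff_exists.mp (Ideal.height_ne_top_of_isPrime (I := P))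
  obtain ⟨b, hb⟩ := ENat.ne_top_iff_exists.mp (Ideal.height_ne_top_of_isPrime (I := Q))
  obtain ⟨c, hc⟩ := ENat.ne_top_iff_exists.mp
    (Ideal.height_ne_top_of_isPrime (I := Q.map (Ideal.Quotient.mk P)))
  have h01 : (⊥ : Ideal A).height < P.height := Ideal.height_strict_mono_of_isPrime hPbot
  have h12 : P.height < Q.height := Ideal.height_strict_mono_of_isPrime hlt
  have h3 : Q.height ≤ 3 := by
    have h := (Ideal.height_le_ringKrullDim_of_isPrime (I := Q)).trans hdimA
    exact WithBot.coe_le_coe.mp h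
  have hsum := add_le_height_of_le P Q hPQ a c ha.le hc.le
  rw [Ideal.height_bot, ← ha] at h01
  rw [← ha, ← hb] at h12
  rw [← hb] at h3 hsum
  have h01' : 0 < a := by exact_mod_cast h01
  have h12' : a < b := by exact_mod_cast h12
  have h3' : b ≤ 3 := by exact_mod_cast h3
  have hsum' : a + c ≤ b := by exact_mod_cast hsum
  refine ⟨hPQ, ?_, ?_⟩
  · rw [IsLocalization.AtPrime.ringKrullDim_eq_height P (Localization.AtPrime P), ← ha]
    exact WithBot.coe_le_coe.mpr (by exact_mod_cast (by omega : a ≤ 2))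
  · rw [← hc]
    exact_mod_cast (by omega : c ≤ 2)

/-- **Regular models for composite valuations of threefolds** ([CP-I] Prop. 5.1, case "`V` has
rank greater than one", via [NS14] §3.1 with both inputs supplied by resolution of excellent
surfaces — a different published route than the print's explicit models `R₁`, `S` (HAL p. 16); the
field-base twin of `Resolution.exists_model_regular_of_lt_of_cjs`): `K/k` finitely generated of
`trdeg ≤ 3`, `O < O₁ < K` valuation rings containing `k`, and `R ⊆ O` a finitely generated model
with `Frac R = K`. Then some finitely generated `A ⊇ R` inside `O` is regular at the centre of
`O`: adjoin `x ∈ 𝔪_O ∖ 𝔪_{O₁}`; `dims_of_separating_affineModel` bounds the two dimensions by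
`2`; `exists_model_regular_of_cjs` uniformizes `ν₁` (Cor. 2.14, `novacoskiSpivakovsky2014_cor214`),
`exists_residueModel_regular_of_cjs` uniformizes `ν₂` above the residue model (Cor. 2.17,
`novacoskiSpivakovsky2014_cor217`), and the blowing up of §3.1 (`novacoskiSpivakovsky2014_step`)
concludes. [cite: CossartPiltant2008, Prop. 5.1 (HAL p. 16)]
[cite: NovacoskiSpivakovsky2014, §3.1] [cite: CossartJannsenSaito2020, Thm. 1.2] -/
theorem exists_affineModel_regular_of_lt_of_cjs (hCJS : CossartJannsenSaito2020General.{u})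
    (h3 : Algebra.trdeg k K ≤ 3)
    (O O₁ : ValuationSubring K) (hO : O ≤ O₁) (hne : O ≠ O₁) (hO₁ : O₁ ≠ ⊤)
    (hk : ∀ c : k, algebraMap k K c ∈ O)
    (R : Subalgebra k K) (hRfg : R.FG) [hRfrac : IsFractionRing R K]
    (hRO : R.toSubring ≤ O.toSubring) :
    ∃ (A : Subalgebra k K) (hA : A.toSubring ≤ O.toSubring), R ≤ A ∧ A.FG ∧
      IsRegularLocalRing (Localization.AtPrime ((maximalIdeal O).comap (Subring.inclusion hA))) := by
  classical
  have hexc : IsExcellentRing k := isExcellentRing_of_field k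
  -- an element `x ∈ 𝔪_O ∖ 𝔪_{O₁}`
  obtain ⟨y, hyO₁, hyO⟩ : ∃ y : K, y ∈ O₁ ∧ y ∉ O := by
    by_contra h
    push Not at h
    exact hne (le_antisymm hO fun z hz => h z hz)
  have hy0 : y ≠ 0 := fun h0 => hyO (by rw [h0]; exact O.zero_mem)
  set x : K := y⁻¹ with hxdef
  have hx0 : x ≠ 0 := inv_ne_zero hy0
  have hxO : x ∈ O := (O.mem_or_inv_mem y).resolve_left hyO
  have hxv : O.valuation x < 1 := by
    change O.valuation ((⟨x, hxO⟩ : O) : K) < 1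
    rw [← ValuationSubring.valuation_lt_one_iff, mem_maximalIdeal, mem_nonunits_iff]
    intro hu
    apply hyO
    have := inv_mem_of_isUnit O hxO hu
    rwa [hxdef, inv_inv] at this
  have hxv₁ : O₁.valuation x = 1 := by
    apply le_antisymm ((O₁.valuation_le_one_iff x).mpr (hO hxO))
    have h := (O₁.valuation_le_one_iff x⁻¹).mpr (by rw [hxdef, inv_inv]; exact hyO₁)
    rwa [map_inv₀, inv_le_one₀ ((Valuation.pos_iff _).mpr hx0)] at h
  -- the model `R' = R[x]`
  let R' : Subalgebra k K := R ⊔ Algebra.adjoin k {x}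
  have hRR' : R ≤ R' := le_sup_left
  have hR'fg : R'.FG := hRfg.sup ⟨{x}, by rw [Finset.coe_singleton]⟩
  have hR'O : R'.toSubring ≤ O.toSubring := by
    have : R' ≤ ({ O.toSubring with algebraMap_mem' := hk } : Subalgebra k K) :=
      sup_le (fun z hz => hRO hz) (Algebra.adjoin_le (Set.singleton_subset_iff.mpr hxO))
    exact fun z hz => this hz
  have hR'O₁ : R'.toSubring ≤ O₁.toSubring := hR'O.trans hO
  haveI hR'frac' : IsFractionRing R' K := isFractionRing_subalgebra_of_le R R' hRR'
  haveI hR'frac : IsFractionRing R'.toSubring K := hR'frac'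
  have hxR' : x ∈ R' :=
    (le_sup_right : Algebra.adjoin k {x} ≤ R') (Algebra.subset_adjoin (Set.mem_singleton x))
  haveI : IsNoetherianRing R' := isNoetherianRing_of_fg hR'fg
  haveI : Algebra.FiniteType k R' := (Subalgebra.fg_iff_finiteType _).mp hR'fg
  have hdimR' : ringKrullDim R' ≤ 3 := by
    have h := ringKrullDim_le_of_fg_of_trdeg_le R' hR'fg (d := 3) (by exact_mod_cast h3)
    exact_mod_cast h
  -- the centres on `R'`
  let Q : Ideal R' := (maximalIdeal O).comap (Subring.inclusion hR'O)
  let P : Ideal R' := (maximalIdeal O₁).comap (Subring.inclusion hR'O₁)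
  haveI : Q.IsPrime := Ideal.IsPrime.comap _
  haveI : P.IsPrime := Ideal.IsPrime.comap _
  have hQ : ∀ z : R', z ∈ Q ↔ O.valuation (z : K) < 1 := fun z => by
    rw [Ideal.mem_comap, ValuationSubring.valuation_lt_one_iff]; rfl
  have hP : ∀ z : R', z ∈ P ↔ O₁.valuation (z : K) < 1 := fun z => by
    rw [Ideal.mem_comap, ValuationSubring.valuation_lt_one_iff]; rfl
  obtain ⟨-, hdimP, -⟩ := dims_of_separating_affineModel O O₁ hO hO₁ R' hR'fg hR'O hdimR'
    x hxR' hxv hxv₁ Q P hQ hP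
  have hexcP : IsExcellentRing (Localization.AtPrime P) := isExcellentRing_localization_atPrime hexc P
  -- Cor. 2.14: a model regular at the centre of `ν₁`
  have h₁ := exists_model_regular_of_cjs hCJS O₁ R' hR'fg hR'O₁ P hP hexcP hdimP
  obtain ⟨A, hA, hR'A, hAfg, hregPA⟩ :=
    novacoskiSpivakovsky2014_cor214 O O₁ hO R' hR'fg hR'frac' hR'O h₁
  -- Cor. 2.17 on `A`
  haveI hAfrac' : IsFractionRing A K := isFractionRing_subalgebra_of_le R' A hR'A
  haveI hAfrac : IsFractionRing A.toSubring K := hAfrac'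
  have hAO₁ : A.toSubring ≤ O₁.toSubring := hA.trans hO
  have hdimA : ringKrullDim A ≤ 3 := by
    have h := ringKrullDim_le_of_fg_of_trdeg_le A hAfg (d := 3) (by exact_mod_cast h3)
    exact_mod_cast h
  let QA : Ideal A := (maximalIdeal O).comap (Subring.inclusion hA)
  let PA : Ideal A := (maximalIdeal O₁).comap (Subring.inclusion hAO₁)
  haveI : QA.IsPrime := Ideal.IsPrime.comap _
  haveI : PA.IsPrime := Ideal.IsPrime.comap _
  have hQA : ∀ z : A, z ∈ QA ↔ O.valuation (z : K) < 1 := fun z => by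
    rw [Ideal.mem_comap, ValuationSubring.valuation_lt_one_iff]; rfl
  have hPA : ∀ z : A, z ∈ PA ↔ O₁.valuation (z : K) < 1 := fun z => by
    rw [Ideal.mem_comap, ValuationSubring.valuation_lt_one_iff]; rfl
  obtain ⟨hPQA, -, hdimQPA⟩ := dims_of_separating_affineModel O O₁ hO hO₁ A hAfg hA hdimA
    x (hR'A hxR') hxv hxv₁ QA PA hQA hPA
  have h₂ := exists_residueModel_regular_of_cjs hCJS hexc O O₁ hO A hA hAfg QA PA hQA hPA hPQA
    hdimQPA
  obtain ⟨A₂, hA₂, hAA₂, hA₂fg, hregP₂, hregQ₂⟩ :=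
    novacoskiSpivakovsky2014_cor217 O O₁ hO A hA hAfg hAfrac' hregPA h₂
  -- §3.1, final step
  haveI hA₂frac : IsFractionRing A₂.toSubring K :=
    isFractionRing_subalgebra_of_le A A₂ hAA₂
  obtain ⟨A₃, hA₃, hA₂₃, hA₃fg, hreg₃⟩ :=
    novacoskiSpivakovsky2014_step O O₁ hO A₂ hA₂ hA₂fg hA₂frac hregP₂ hregQ₂
  exact ⟨A₃, hA₃, hRR'.trans (hR'A.trans (hAA₂.trans hA₂₃)), hA₃fg, hreg₃⟩

/-- **[CP-I] Prop. 5.1, case "`V` has rank greater than one"** (module notation `rk Γ > 1`): a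
`k`-valuation ring of a finitely generated `K/k`
of `trdeg ≤ 3` which is NOT of rank `≤ 1` admits local uniformization (from resolution of
excellent surfaces). Such an `O` is `≠ K` and not of rank one, so by
`nonempty_rankOne_of_overrings` it has an overring `O < O₁ < K`, and
`exists_affineModel_regular_of_lt_of_cjs` applies to an affine model (`exists_affineModel`).
[cite: CossartPiltant2008, Prop. 5.1 (HAL p. 16)] [cite: NovacoskiSpivakovsky2014, Thm. 1.1, §3.1]
[cite: CossartJannsenSaito2020, Thm. 1.2] -/
theorem isLocallyUniformizable_of_isEmpty_rankLeOne_of_cjs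
    (hCJS : CossartJannsenSaito2020General.{u})
    (hfg : (⊤ : IntermediateField k K).FG) (h3 : Algebra.trdeg k K ≤ 3)
    (O : ValuationSubring K) (hk : ∀ c : k, algebraMap k K c ∈ O)
    (hr : IsEmpty O.valuation.RankLeOne) : IsLocallyUniformizable k K O := by
  classical
  by_cases hO : O = ⊤
  · exact isLocallyUniformizable_of_eq_top hfg hO
  -- `O` is not of rank one, so it has an overring `O < O₁ < K`
  obtain ⟨O₁, hOO₁, hne, hO₁⟩ : ∃ O₁ : ValuationSubring K, O ≤ O₁ ∧ O ≠ O₁ ∧ O₁ ≠ ⊤ := by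
    by_contra h
    push Not at h
    have h2 : ∀ S : ValuationSubring K, O ≤ S → S = O ∨ S = ⊤ := fun S hS => by
      by_cases hSO : S = O
      · exact Or.inl hSO
      · exact Or.inr (h S hS (Ne.symm hSO))
    obtain ⟨h1⟩ := nonempty_rankOne_of_overrings O hO h2
    exact hr.false h1.toRankLeOne
  obtain ⟨R, hRO, hRfg, hRfr⟩ := exists_affineModel k K hfg O hk
  haveI := hRfr
  obtain ⟨A, hA, hRA, hAfg, hreg⟩ :=
    exists_affineModel_regular_of_lt_of_cjs hCJS h3 O O₁ hOO₁ hne hO₁ hk R hRfg hRO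
  exact ⟨A, hA, hAfg, isFractionRing_subalgebra_of_le R A hRA, hreg⟩

end Composite

/-! ## Transcendental residue field (module notation `dim V₀ > 0`): the centre is not a closed point -/

section Residue

variable {k K : Type u} [Field k] [Field K] [Algebra k K]

/-- **[CP-I] Prop. 5.1, case "`κ(V)/k` is transcendental"** (module notation `dim V₀ > 0`;
printed: "First assume that `κ(V)/k` is transcendental. Let `t ∈ V` be such that its image in
`κ(V)` is transcendental over `k`. Then `K/k(t)` is an algebraic function field of transcendence
degree two. By e.g. [36], there exists a local uniformization of `V/k(t)`, hence of `V/k` since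
`k(t) ⊂ V`.", HAL p. 16, l. 17–19), from resolution of excellent surfaces and along a different
route (base field `k` kept, non-maximal centre): a `k`-valuation ring `O` of a finitely generated
`K/k` of `trdeg ≤ 3` whose residue field is transcendental over `k` admits local uniformization.
Proof: pick `y ∈ O` with residue `ȳ` transcendental over `k`
(`trdeg_ne_zero_iff`) and an affine model `R ∋ y` of `O` (`exists_affineModel`); the centre `P` of
`O` on `R` is not maximal, since `R/P ↪ κ(O)` contains the transcendental `ȳ` while a field
finitely generated over `k` has transcendence degree `= dim = 0`
(`exists_ringKrullDim_eq_and_trdeg_eq`); hence `ht P < ht M ≤ dim R ≤ 3` for a maximal `M ⊋ P`,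
`R_P` is excellent of dimension `≤ 2`, and `exists_model_regular_of_cjs` gives the regular model.
[cite: CossartPiltant2008, Prop. 5.1 (HAL p. 16)] [cite: CossartJannsenSaito2020, Thm. 1.2] -/
theorem isLocallyUniformizable_of_residueTrdeg_ne_zero_of_cjs
    (hCJS : CossartJannsenSaito2020General.{u})
    (hfg : (⊤ : IntermediateField k K).FG) (h3 : Algebra.trdeg k K ≤ 3)
    (O : ValuationSubring K) (hk : ∀ c : k, algebraMap k K c ∈ O)
    (hτ : residueTrdeg k O hk ≠ 0) : IsLocallyUniformizable k K O := by
  classical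
  letI := algebraOfMem k O hk
  haveI := isScalarTower_algebraOfMem k O hk
  -- a lift `y ∈ O` of a residue-transcendental element
  have hτ' : Algebra.trdeg k (ResidueField O) ≠ 0 := hτ
  obtain ⟨y, hy⟩ : ∃ y : O, Transcendental k (residue O y) := by
    obtain ⟨z, hz⟩ := (trdeg_ne_zero_iff.mp hτ').transcendental
    obtain ⟨y, rfl⟩ := Ideal.Quotient.mk_surjective z
    exact ⟨y, hz⟩
  -- an affine model `R ∋ y` of `O`
  obtain ⟨R₀, hR₀O, hR₀fg, hR₀fr⟩ := exists_affineModel k K hfg O hk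
  haveI := hR₀fr
  let R : Subalgebra k K := R₀ ⊔ Algebra.adjoin k {(y : K)}
  have hR₀R : R₀ ≤ R := le_sup_left
  have hRfg : R.FG := hR₀fg.sup ⟨{(y : K)}, by rw [Finset.coe_singleton]⟩
  have hRO : R.toSubring ≤ O.toSubring := by
    have : R ≤ ({ O.toSubring with algebraMap_mem' := hk } : Subalgebra k K) :=
      sup_le (fun z hz => hR₀O hz) (Algebra.adjoin_le (Set.singleton_subset_iff.mpr y.2))
    exact fun z hz => this hz
  haveI hRfr : IsFractionRing R K := isFractionRing_subalgebra_of_le R₀ R hR₀R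
  have hyR : (y : K) ∈ R :=
    (le_sup_right : Algebra.adjoin k {(y : K)} ≤ R) (Algebra.subset_adjoin (Set.mem_singleton _))
  haveI : IsNoetherianRing R := isNoetherianRing_of_fg hRfg
  haveI : Algebra.FiniteType k R := (Subalgebra.fg_iff_finiteType _).mp hRfg
  have hdimR : ringKrullDim R ≤ 3 := by
    have h := ringKrullDim_le_of_fg_of_trdeg_le R hRfg (d := 3) (by exact_mod_cast h3)
    exact_mod_cast h
  -- the centre `P` of `O` on `R`
  let P : Ideal R := (maximalIdeal O).comap (Subring.inclusion hRO)
  haveI : P.IsPrime := Ideal.IsPrime.comap _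
  have hP : ∀ z : R, z ∈ P ↔ O.valuation (z : K) < 1 := fun z => by
    rw [Ideal.mem_comap, ValuationSubring.valuation_lt_one_iff]; rfl
  -- the image `ȳ` of `y` in `R / P ↪ κ(O)` is transcendental over `k`
  have hybar : Transcendental k (Ideal.Quotient.mk P ⟨(y : K), hyR⟩) := by
    rintro ⟨q, hq0, hq⟩
    refine hy ⟨q, hq0, ?_⟩
    have h1 : Polynomial.aeval (⟨(y : K), hyR⟩ : R) q ∈ P := by
      rw [← Ideal.Quotient.eq_zero_iff_mem, ← Ideal.Quotient.mkₐ_eq_mk k,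
        ← Polynomial.aeval_algHom_apply]
      exact hq
    rw [hP] at h1
    have e1 : Polynomial.aeval (y : K) q = ((Polynomial.aeval (⟨(y : K), hyR⟩ : R) q : R) : K) :=
      Polynomial.aeval_algebraMap_apply K (⟨(y : K), hyR⟩ : R) q
    have e2 : Polynomial.aeval (y : K) q = ((Polynomial.aeval y q : O) : K) :=
      Polynomial.aeval_algebraMap_apply K y q
    rw [← e1, e2, ← ValuationSubring.valuation_lt_one_iff] at h1
    have hres : residue O (Polynomial.aeval y q) = 0 := (residue_eq_zero_iff _).mpr h1
    have e3 := Polynomial.aeval_algHom_apply (IsScalarTower.toAlgHom k O (ResidueField O)) y q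
    simp only [IsScalarTower.coe_toAlgHom', ResidueField.algebraMap_eq] at e3
    rw [e3, hres]
  -- hence `P` is not maximal (`R/P` would be a field of transcendence degree `0`)
  have hPmax : ¬ P.IsMaximal := by
    intro hmax
    have hfield : IsField (R ⧸ P) := (Ideal.Quotient.maximal_ideal_iff_isField_quotient P).mp hmax
    obtain ⟨n, hn, htr⟩ := exists_ringKrullDim_eq_and_trdeg_eq k (R ⧸ P)
    have h0 : ringKrullDim (R ⧸ P) = 0 := ringKrullDim_eq_zero_of_isField hfield
    rw [hn] at h0
    have hn0 : n = 0 := by exact_mod_cast h0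
    rw [hn0, Nat.cast_zero, trdeg_eq_zero_iff] at htr
    exact hybar (htr.isAlgebraic _)
  obtain ⟨M, hM, hPM⟩ := Ideal.exists_le_maximal P (Ideal.IsPrime.ne_top inferInstance)
  have hlt : P < M := lt_of_le_of_ne hPM fun h => hPmax (h ▸ hM)
  haveI := hM.isPrime
  -- `dim R_P = ht P < ht M ≤ dim R ≤ 3`
  have hdimP : ringKrullDim (Localization.AtPrime P) ≤ 2 := by
    obtain ⟨a, ha⟩ := ENat.ne_top_iff_exists.mp (Ideal.height_ne_top_of_isPrime (I := P))
    obtain ⟨b, hb⟩ := ENat.ne_top_iff_exists.mp (Ideal.height_ne_top_of_isPrime (I := M))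
    have h12 : P.height < M.height := Ideal.height_strict_mono_of_isPrime hlt
    have h3' : M.height ≤ 3 :=
      WithBot.coe_le_coe.mp ((Ideal.height_le_ringKrullDim_of_isPrime (I := M)).trans hdimR)
    rw [← ha, ← hb] at h12
    rw [← hb] at h3'
    have h12' : a < b := by exact_mod_cast h12
    have h3'' : b ≤ 3 := by exact_mod_cast h3'
    rw [IsLocalization.AtPrime.ringKrullDim_eq_height P (Localization.AtPrime P), ← ha]
    exact WithBot.coe_le_coe.mpr (by exact_mod_cast (by omega : a ≤ 2))
  have hexc : IsExcellentRing (Localization.AtPrime P) :=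
    isExcellentRing_localization_atPrime (isExcellentRing_of_field k) P
  obtain ⟨A, hA, hRA, hAfg, hreg⟩ := exists_model_regular_of_cjs hCJS O R hRfg hRO P hP hexc hdimP
  exact ⟨A, hA, hAfg, isFractionRing_subalgebra_of_le R A hRA, hreg⟩

end Residue

/-! ## The leaf -/

/-- **Cossart–Piltant 2008, Proposition 5.1** — the leaf `RankReduction` of the verbatim
rendering, PROVED from resolution of singularities of excellent surfaces
(`Resolution.CossartJannsenSaito2020General`, [CJS] Thm. 1.2, standing in for the print's [36] =
Lipman 1978: "By e.g. [36]", "Again by [36]", HAL p. 16, l. 18, l. 41): for `K/k` a function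
field of transcendence
degree three and `O` a `k`-valuation ring of `K` of rank `> 1`
(`isLocallyUniformizable_of_isEmpty_rankLeOne_of_cjs`, Zariski's composite-valuation argument in
Novacoski–Spivakovsky's form) or with `κ(O)/k` transcendental
(`isLocallyUniformizable_of_residueTrdeg_ne_zero_of_cjs`), local uniformization holds for `O`.
[cite: CossartPiltant2008, Prop. 5.1 (HAL p. 16)] [cite: NovacoskiSpivakovsky2014, Thm. 1.1, §3.1]
[cite: CossartJannsenSaito2020, Thm. 1.2] -/
theorem rankReduction_of_cjs (hCJS : CossartJannsenSaito2020General.{u}) : RankReduction.{u} := by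
  intro k K _ _ _ hfg h3 O hk h
  rcases h with hr | hτ
  · exact isLocallyUniformizable_of_isEmpty_rankLeOne_of_cjs hCJS hfg h3.le O hk hr
  · exact isLocallyUniformizable_of_residueTrdeg_ne_zero_of_cjs hCJS hfg h3.le O hk hτ

/-- **[CP-I] architecture with Prop. 5.1 discharged**: `LU3DiffFinite` (local uniformization of
function fields of dimension three over differentially finite fields of characteristic `p`)
follows from resolution of excellent surfaces, the reduction to Artin–Schreier / purely
inseparable coverings (Thm. 7.2) and [CP-II]'s Main theorem — `lu3_of_leaves` with the leaf
`p51` supplied by `rankReduction_of_cjs`.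
[cite: CossartPiltant2008, Prop. 5.1, Thm. 7.2 (HAL pp. 3–4, 16)] [cite: CossartJannsenSaito2020, Thm. 1.2] -/
theorem lu3DiffFinite_of_cjs_of_leaves (hCJS : CossartJannsenSaito2020General.{u})
    (t72 : ReductionToArtinSchreier.{u}) (cp2 : CossartPiltant2009Main.{u}) :
    LU3DiffFinite.{u} :=
  lu3_of_leaves (rankReduction_of_cjs hCJS) t72 cp2

end Literature.AlgebraicGeometry.CossartPiltant200819.CP2008
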